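import Mathlib
import HarnessLib
import Literature.Probability.MarkovChains.NashViaIsoperimetry
import Literature.Probability.MarkovChains.PathWalkNashInequality

/-!
# Isoperimetry ⇒ Nash inequality of the first kind: Saloff-Coste 1997, §3.3.2, Lemma 3.3.13 and Theorem 3.3.11

HONEST FRAMING: exact (Metropolis-corrected) sampling algorithms for lattice gauge theory; figures
of merit are autocorrelation/cost numbers at stated couplings and volumes; no continuum-physics claim.

L. Saloff-Coste, *Lectures on finite Markov chains*, LNM 1665 (1997), §3.3.2 "Isoperimetry and Nash
inequalities", pp. 90–92.

**THEOREM 3.3.11.** Assume that `(K, π)` satisfies (3.3.7) `π(A)^{(d−1)/d} ≤ S Q(∂A)` for all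
`A ⊂ X` with `π(A) ≤ ½`. Then `Var_π(g)^{1+2/d} ≤ 8 S² 𝓔(g,g) ‖g‖₁^{4/d}` for all `g`, i.e. the Nash
inequality (2.3.1) `NashInequality π K (8S²) d` of `NashInequality.lean`.

**LEMMA 3.3.13, eq. (3.3.8)** (the half used by the theorem): under (3.3.7) — i.e. `I_d ≥ 1/S` —
`Σ_e |df(e)|Q(e) ≥ S⁻¹ ‖f − c‖_q` for `c` a median of `f`, `q = d/(d−1)`.

## Formalization notes
* The printed proof of (3.3.8) splits `f − c = f₊ − f₋` at a median `c`, applies the co-area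
  formula to `f₊` and `f₋` (whose level sets have `π`-mass `≤ ½`) and recombines by duality;
  here the two halves are the co-area/Minkowski induction `lqNorm_le_of_isoperimetry` of
  `IsoperimetricSobolevInequality.lean` (with `T = 0`) and the recombination is Minkowski
  (`‖f₊ + f₋‖_q ≤ ‖f₊‖_q + ‖f₋‖_q`) plus the pointwise identity `|df(e)| = |df₊(e)| + |df₋(e)|`.
* THEOREM 3.3.11 then follows the print: `f = sgn(g − c)|g − c|²` has median `0`; (3.3.8),
  the Cauchy–Schwarz step "as in the proof of Lemma 3.3.7" (`gradLOne_mulAbs_sq_le`), the Hölder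
  step (`piInner_rpow_le`) and the algebra (`Saloffcoste1997_nash_algebra`) of
  `NashViaIsoperimetry.lean`; finally `Var_π(g) ≤ ‖g − c‖₂²` (`piInner_sub_const_eq`) and
  `‖g − c‖₁ ≤ ‖g‖₁` for a median `c` (`lOneNorm_sub_median_le`, "Since `c` is a median of `g`").
* DEFINITION 3.3.12 (the constant `I_d`) is not introduced as a definition: hypothesis (3.3.7) is
  carried explicitly with its constant `S`, exactly as THEOREM 3.3.11 is printed.  A median is the
  pair of conditions `π{f > c} ≤ ½`, `π{f < c} ≤ ½` (`exists_median`, `CheegerInequality.lean`).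
* SCOPE: `d > 1`; `K` row-stochastic with `πK = π`, `π` a probability vector.  The examples
  3.3.3–3.3.5 (THEOREMS 3.3.14–3.3.18, grids) are NOT typed.

## Content
`lqNorm_le_of_isoperimetry_half` (the `T = 0`, mass-`≤ ½` form of the induction),
**`Saloffcoste1997_lemma_3_3_13_le`** ((3.3.8) at a median), the tree's `lOneNorm_sub_median_le` (`PathWalkNashInequality.lean`),
**`Saloffcoste1997_thm_3_3_11`**.
-/

namespace Literature.Probability.MarkovChains

open Finset

variable {X : Type*} [Fintype X] [DecidableEq X]

/-! ## (3.3.8): `‖f − c‖_q ≤ S Σ_e |df(e)| Q(e)` at a median -/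

/-- The co-area/Minkowski induction for a non-negative `ψ` whose support has mass `≤ ½`, under
(3.3.7) in the form `π(A)^{1/q} ≤ S·Q(∂A)` (`π(A) ≤ ½`): `‖ψ‖_q ≤ S Σ_e|dψ(e)|Q(e)`
("`Σ_e |df₊(e)|Q(e) = ∫₀^∞ Q(∂F_{+,t}) dt ≥ I_d ∫₀^∞ π(F_{+,t})^{1/q} dt`").
[cite: Saloffcoste1997, §3.3.2 proof of Lemma 3.3.13] -/
theorem lqNorm_le_of_isoperimetry_half {π : X → ℝ} (hπ0 : ∀ x, 0 ≤ π x) (P : X → X → ℝ)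
    {q S : ℝ} (hq : 1 ≤ q)
    (hiso : ∀ A : Finset X, ∑ x ∈ A, π x ≤ 1 / 2 → (∑ x ∈ A, π x) ^ (1 / q) ≤ S * boundaryMeasure π P A)
    {ψ : X → ℝ} (hψ : ∀ x, 0 ≤ ψ x) (hhalf : ∑ x ∈ univ.filter (fun x => 0 < ψ x), π x ≤ 1 / 2) :
    lqNorm π q ψ ≤ S * gradLOne π P ψ := by
  have h := lqNorm_le_of_isoperimetry hπ0 P hq S 0 (Fintype.card X) ψ hψ (card_le_univ _)
    (fun A _ hAψ => by
      have hAle : ∑ x ∈ A, π x ≤ 1 / 2 :=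
        (sum_le_sum_of_subset_of_nonneg (fun x hx => mem_filter.mpr ⟨mem_univ x, hAψ x hx⟩)
          (fun x _ _ => hπ0 x)).trans hhalf
      rw [zero_mul, add_zero]
      exact hiso A hAle)
  rwa [zero_mul, add_zero] at h

/-- `|max(a−c,0) − max(b−c,0)| + |max(c−a,0) − max(c−b,0)| = |a − b|`
("`|df(e)| = |df₊(e)| + |df₋(e)|`"). [folklore] -/
private theorem abs_posPart_sub_add_abs_negPart_sub (a b c : ℝ) :
    |max (a - c) 0 - max (b - c) 0| + |max (c - a) 0 - max (c - b) 0| = |a - b| := by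
  rcases le_total c a with ha | ha <;> rcases le_total c b with hb | hb
  · rw [max_eq_left (by linarith : (0 : ℝ) ≤ a - c), max_eq_left (by linarith : (0 : ℝ) ≤ b - c),
      max_eq_right (by linarith : c - a ≤ 0), max_eq_right (by linarith : c - b ≤ 0), sub_self,
      abs_zero, add_zero, show a - c - (b - c) = a - b by ring]
  · rw [max_eq_left (by linarith : (0 : ℝ) ≤ a - c), max_eq_right (by linarith : b - c ≤ 0),
      max_eq_right (by linarith : c - a ≤ 0), max_eq_left (by linarith : (0 : ℝ) ≤ c - b), sub_zero,
      zero_sub, abs_neg, abs_of_nonneg (by linarith : (0 : ℝ) ≤ a - c),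
      abs_of_nonneg (by linarith : (0 : ℝ) ≤ c - b), abs_of_nonneg (by linarith : (0 : ℝ) ≤ a - b)]
    ring
  · rw [max_eq_right (by linarith : a - c ≤ 0), max_eq_left (by linarith : (0 : ℝ) ≤ b - c),
      max_eq_left (by linarith : (0 : ℝ) ≤ c - a), max_eq_right (by linarith : c - b ≤ 0), zero_sub,
      abs_neg, sub_zero, abs_of_nonneg (by linarith : (0 : ℝ) ≤ b - c),
      abs_of_nonneg (by linarith : (0 : ℝ) ≤ c - a), abs_of_nonpos (by linarith : a - b ≤ 0)]
    ring
  · rw [max_eq_right (by linarith : a - c ≤ 0), max_eq_right (by linarith : b - c ≤ 0),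
      max_eq_left (by linarith : (0 : ℝ) ≤ c - a), max_eq_left (by linarith : (0 : ℝ) ≤ c - b),
      sub_self, abs_zero, zero_add, show c - a - (c - b) = -(a - b) by ring, abs_neg]

/-- **LEMMA 3.3.13, eq. (3.3.8): `Σ_e |df(e)| Q(e) ≥ S⁻¹ ‖f − c‖_q` for `c` a median of `f`**
(`π{f > c} ≤ ½`, `π{f < c} ≤ ½`), under (3.3.7) in the form `π(A)^{1/q} ≤ S Q(∂A)` for `π(A) ≤ ½`
(i.e. `I_d ≥ S⁻¹`, `q = d/(d−1)`); typed as `‖f − c‖_q ≤ S Σ_e|df(e)|Q(e)`.  `π ≥ 0`, `q ≥ 1`.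
[cite: Saloffcoste1997, §3.3.2 Lemma 3.3.13, eq. (3.3.8)] -/
theorem Saloffcoste1997_lemma_3_3_13_le {π : X → ℝ} (hπ0 : ∀ x, 0 ≤ π x) (P : X → X → ℝ)
    {q S : ℝ} (hq : 1 ≤ q)
    (hiso : ∀ A : Finset X, ∑ x ∈ A, π x ≤ 1 / 2 → (∑ x ∈ A, π x) ^ (1 / q) ≤ S * boundaryMeasure π P A)
    {f : X → ℝ} {c : ℝ} (hc1 : ∑ x ∈ univ.filter (fun x => c < f x), π x ≤ 1 / 2)
    (hc2 : ∑ x ∈ univ.filter (fun x => f x < c), π x ≤ 1 / 2) :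
    lqNorm π q (fun x => f x - c) ≤ S * gradLOne π P f := by
  set fp : X → ℝ := fun x => max (f x - c) 0 with hfp
  set fm : X → ℝ := fun x => max (c - f x) 0 with hfm
  -- the two halves
  have hp : lqNorm π q fp ≤ S * gradLOne π P fp := by
    refine lqNorm_le_of_isoperimetry_half hπ0 P hq hiso (fun x => le_max_right _ _) ?_
    have e : univ.filter (fun x => 0 < fp x) = univ.filter (fun x => c < f x) :=
      filter_congr fun x _ => by simp only [hfp, lt_max_iff, lt_self_iff_false, or_false, sub_pos]
    rw [e]; exact hc1
  have hm : lqNorm π q fm ≤ S * gradLOne π P fm := by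
    refine lqNorm_le_of_isoperimetry_half hπ0 P hq hiso (fun x => le_max_right _ _) ?_
    have e : univ.filter (fun x => 0 < fm x) = univ.filter (fun x => f x < c) :=
      filter_congr fun x _ => by simp only [hfm, lt_max_iff, lt_self_iff_false, or_false, sub_pos]
    rw [e]; exact hc2
  -- `|f − c| = f₊ + f₋` and `|df| = |df₊| + |df₋|`
  have e1 : lqNorm π q (fun x => f x - c) = lqNorm π q (fun x => fp x + fm x) := by
    unfold lqNorm
    congr 1
    refine sum_congr rfl fun x _ => ?_
    congr 2
    show |f x - c| = |fp x + fm x|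
    rcases le_total 0 (f x - c) with h | h
    · rw [show fp x = f x - c from max_eq_left h, show fm x = 0 from max_eq_right (by linarith),
        add_zero]
    · rw [show fp x = 0 from max_eq_right h, show fm x = c - f x from max_eq_left (by linarith),
        zero_add, abs_sub_comm]
  have e2 : gradLOne π P fp + gradLOne π P fm = gradLOne π P f := by
    unfold gradLOne
    rw [← sum_add_distrib]
    refine sum_congr rfl fun x _ => ?_
    rw [← sum_add_distrib]
    refine sum_congr rfl fun y _ => ?_
    rw [← mul_add, abs_posPart_sub_add_abs_negPart_sub (f x) (f y) c]
  rw [e1]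
  calc lqNorm π q (fun x => fp x + fm x) ≤ lqNorm π q fp + lqNorm π q fm := lqNorm_add_le hπ0 hq _ _
    _ ≤ S * gradLOne π P fp + S * gradLOne π P fm := add_le_add hp hm
    _ = S * gradLOne π P f := by rw [← mul_add, e2]

/-! ## THEOREM 3.3.11 -/

-- `lOneNorm_sub_median_le` (‖g − c‖₁ ≤ ‖g‖₁ for a median `c`) is the tree's
-- `PathWalkNashInequality.lean` version (same statement); imported, not re-declared.

/-- `0 < u|u| ↔ 0 < u`. [folklore] -/
private theorem mulAbs_pos_iff (u : ℝ) : 0 < u * |u| ↔ 0 < u := by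
  constructor
  · intro h
    by_contra hu
    push Not at hu
    nlinarith [abs_nonneg u]
  · intro h
    rw [abs_of_pos h]
    exact mul_pos h h

/-- `u|u| < 0 ↔ u < 0`. [folklore] -/
private theorem mulAbs_neg_iff (u : ℝ) : u * |u| < 0 ↔ u < 0 := by
  constructor
  · intro h
    by_contra hu
    push Not at hu
    nlinarith [abs_nonneg u, mul_nonneg hu (abs_nonneg u)]
  · intro h
    rw [abs_of_neg h]
    nlinarith

/-- **THEOREM 3.3.11.** If `π(A)^{(d−1)/d} ≤ S Q(∂A)` for all `A ⊂ X` with `π(A) ≤ ½` (eq. (3.3.7)),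
then **`Var_π(g)^{1+2/d} ≤ 8 S² 𝓔(g,g) ‖g‖₁^{4/d}` for every `g`** — the Nash inequality (2.3.1)
`NashInequality π K (8S²) d`.  `K` row-stochastic, `πK = π`, `π ≥ 0` with `Σπ = 1`, `d > 1`, `S ≥ 0`.
[cite: Saloffcoste1997, §3.3.2 Theorem 3.3.11] -/
theorem Saloffcoste1997_thm_3_3_11 {P : X → X → ℝ} (hP : IsRowStochastic P) {π : X → ℝ}
    (hπ : IsStationary π P) (hπ0 : ∀ x, 0 ≤ π x) (hπ1 : ∑ x, π x = 1) {d S : ℝ} (hd : 1 < d)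
    (hS : 0 ≤ S) (hiso : ∀ A : Finset X, ∑ x ∈ A, π x ≤ 1 / 2 →
      (∑ x ∈ A, π x) ^ ((d - 1) / d) ≤ S * boundaryMeasure π P A) :
    NashInequality π P (8 * S ^ 2) d := by
  intro g
  have hd0 : 0 < d := by linarith
  have hd1 : 0 < d - 1 := by linarith
  obtain ⟨c, hc1, hc2⟩ := exists_median hπ1 g
  set h : X → ℝ := fun x => g x - c with hh
  set A := piInner π h h with hAdef
  set E := dirichletForm π P g with hEdef
  set C := ∑ x, π x * |h x| ^ (2 * d / (d - 1)) with hCdef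
  have hA : 0 ≤ A := sum_nonneg fun x _ => mul_nonneg (hπ0 x) (mul_self_nonneg _)
  have hE : 0 ≤ E := dirichletForm_nonneg hπ0 hP.1 g
  have hC : 0 ≤ C := sum_nonneg fun x _ => mul_nonneg (hπ0 x) (Real.rpow_nonneg (abs_nonneg _) _)
  have hEh : dirichletForm π P h = E := by rw [hh, hEdef]; exact dirichletForm_sub_const π P g c
  -- Hölder
  have H1 : A ^ (1 + d) ≤ lOneNorm π h ^ 2 * C ^ (d - 1) := piInner_rpow_le hπ0 hd h
  -- (3.3.8) for `f = h|h|`, whose median is `0`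
  have hq : 1 ≤ d / (d - 1) := by rw [le_div_iff₀ hd1]; linarith
  have hiso' : ∀ B : Finset X, ∑ x ∈ B, π x ≤ 1 / 2 →
      (∑ x ∈ B, π x) ^ (1 / (d / (d - 1))) ≤ S * boundaryMeasure π P B := fun B hB => by
    rw [one_div_div]; exact hiso B hB
  have hc1' : ∑ x ∈ univ.filter (fun x => (0 : ℝ) < h x * |h x|), π x ≤ 1 / 2 := by
    have e : univ.filter (fun x => (0 : ℝ) < h x * |h x|) = univ.filter (fun x => c < g x) :=
      filter_congr fun x _ => by rw [mulAbs_pos_iff, hh]; exact sub_pos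
    rw [e]; exact hc1
  have hc2' : ∑ x ∈ univ.filter (fun x => h x * |h x| < (0 : ℝ)), π x ≤ 1 / 2 := by
    have e : univ.filter (fun x => h x * |h x| < (0 : ℝ)) = univ.filter (fun x => g x < c) :=
      filter_congr fun x _ => by rw [mulAbs_neg_iff, hh]; exact sub_neg
    rw [e]; exact hc2
  have h138 := Saloffcoste1997_lemma_3_3_13_le hπ0 P hq hiso' (f := fun x => h x * |h x|)
    (c := 0) hc1' hc2'
  have e1 : lqNorm π (d / (d - 1)) (fun x => h x * |h x| - 0) = C ^ ((d - 1) / d) := by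
    unfold lqNorm
    rw [one_div_div]
    congr 1
    refine sum_congr rfl fun x _ => ?_
    simp only [sub_zero]
    rw [abs_mul, abs_abs, ← sq, ← Real.rpow_two, ← Real.rpow_mul (abs_nonneg _), mul_div_assoc]
  have e3 : gradLOne π P (fun x => h x * |h x|) ≤ Real.sqrt (8 * E) * Real.sqrt A := by
    rw [← Real.sqrt_mul (by positivity : (0 : ℝ) ≤ 8 * E),
      ← Real.sqrt_sq (gradLOne_nonneg hπ0 hP.1 _), ← hEh]
    exact Real.sqrt_le_sqrt (gradLOne_mulAbs_sq_le hP hπ hπ0 h)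
  rw [e1] at h138
  have H2 : C ^ ((d - 1) / d) ≤ S * (Real.sqrt A * Real.sqrt (8 * E)) := by
    calc C ^ ((d - 1) / d) ≤ S * gradLOne π P (fun x => h x * |h x|) := h138
      _ ≤ S * (Real.sqrt (8 * E) * Real.sqrt A) := mul_le_mul_of_nonneg_left e3 hS
      _ = S * (Real.sqrt A * Real.sqrt (8 * E)) := by ring
  have hN := Saloffcoste1997_nash_algebra hd hA (lOneNorm_nonneg hπ0 h) hS (Real.sqrt_nonneg _)
    hC H1 H2
  rw [Real.sq_sqrt (by positivity : (0 : ℝ) ≤ 8 * E)] at hN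
  -- `Var_π(g) ≤ ‖g − c‖₂² = A` and `‖g − c‖₁ ≤ ‖g‖₁`
  have hVA : lawVariance π g ≤ A := by
    rw [hAdef, hh, piInner_sub_const_eq hπ1 g c]
    nlinarith [sq_nonneg (lawMean π g - c)]
  have hV0 : 0 ≤ lawVariance π g := lawVariance_nonneg hπ0 g
  have hL : lOneNorm π h ≤ lOneNorm π g := lOneNorm_sub_median_le hπ0 hπ1 hc1 hc2
  calc lawVariance π g ^ (1 + 2 / d) ≤ A ^ (1 + 2 / d) :=
        Real.rpow_le_rpow hV0 hVA (by positivity)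
    _ ≤ S ^ 2 * (8 * E) * lOneNorm π h ^ (4 / d) := hN
    _ ≤ S ^ 2 * (8 * E) * lOneNorm π g ^ (4 / d) :=
        mul_le_mul_of_nonneg_left
          (Real.rpow_le_rpow (lOneNorm_nonneg hπ0 h) hL (by positivity)) (by positivity)
    _ = 8 * S ^ 2 * E * lOneNorm π g ^ (4 / d) := by ring

end Literature.Probability.MarkovChains
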